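import Mathlib.MeasureTheory.Integral.Layercake
import Mathlib.Topology.MetricSpace.Cauchy
import Mathlib.Topology.Algebra.InfiniteSum.Real
import Literature.MeasureTheory.TotalVariation.SetwiseBound
import HarnessLib

/-!
# Setwise (total-variation) limits of probability measures, and integrals of bounded functions

Two folklore complements to the `TVClose` calculus of `SetwiseBound.lean`
(`TVClose μ ν ε : ∀ E measurable, |μ(E) − ν(E)| ≤ ε`):

* `TVClose.abs_integral_sub_le` — **integrals of `[0,1]`-valued measurable functions differ by
  at most the setwise distance**: `|∫ g dμ − ∫ g dν| ≤ ε` for finite `μ, ν` with `TVClose μ ν ε` and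
  measurable `0 ≤ g ≤ 1` (layer-cake formula `∫ g dμ = ∫₀¹ μ{g ≥ t} dt`, Mathlib
  `lintegral_eq_lintegral_meas_le`).
* `exists_tvClose_of_cauchy` — **the space of probability measures is complete for the setwise
  (total-variation) distance**: a sequence of probability measures `ρₙ` with
  `TVClose (ρ n) (ρ m) (ε N)` for `n, m ≥ N`, `ε N → 0`, admits a probability measure `P` with
  `TVClose (ρ n) P (ε N)` for `n ≥ N` (the setwise limits `lim ρₙ(E)` form a countably additive set
  function — uniformity in `E` lets one exchange the limit with countable unions — assembled by
  `Measure.ofMeasurable`).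

## References

* P. Billingsley, *Convergence of Probability Measures*, 2nd ed. (Wiley 1999), §1 (setwise
  convergence); V. I. Bogachev, *Measure Theory* I (Springer 2007), Thm. 4.6.3 (Nikodym; here only
  the elementary uniform case is needed).
* D. A. Levin, Y. Peres, E. L. Wilmer, *Markov chains and mixing times* (AMS 2009), Prop. 4.2 /
  Remark 4.3 (`‖μ − ν‖_TV` via bounded test functions).
-/

open MeasureTheory Filter Topology Set Function
open scoped ENNReal

namespace Literature.MeasureTheory.TotalVariation

open _root_.MeasureTheory

variable {α : Type*} [MeasurableSpace α]

/-! ### Integrals of `[0,1]`-valued functions -/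

/-- One-sided setwise bound in `ℝ≥0∞` form: `μ(E) ≤ ν(E) + ε`. [folklore] -/
theorem TVClose.measure_le_add {μ ν : Measure α} [IsFiniteMeasure μ] [IsFiniteMeasure ν] {ε : ℝ}
    (h : TVClose μ ν ε) {E : Set α} (hE : MeasurableSet E) : μ E ≤ ν E + ENNReal.ofReal ε := by
  have h1 : μ.real E ≤ ν.real E + ε := by linarith [(abs_le.1 (h E hE)).2]
  calc μ E = ENNReal.ofReal (μ.real E) := (ENNReal.ofReal_toReal (measure_ne_top μ E)).symm
    _ ≤ ENNReal.ofReal (ν.real E + ε) := ENNReal.ofReal_le_ofReal h1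
    _ ≤ ENNReal.ofReal (ν.real E) + ENNReal.ofReal ε := ENNReal.ofReal_add_le
    _ = ν E + ENNReal.ofReal ε := by rw [measureReal_def, ENNReal.ofReal_toReal (measure_ne_top ν E)]

/-- The layer-cake integral of a `[0,1]`-valued function lives on `(0, 1]`:
`∫⁻ g dμ = ∫⁻_{t ∈ (0,1]} μ{t ≤ g}` (Mathlib `lintegral_eq_lintegral_meas_le`). [folklore] -/
theorem lintegral_eq_setLIntegral_Ioc_measure_le (μ : Measure α) {g : α → ℝ} (hg : Measurable g)
    (h0 : ∀ x, 0 ≤ g x) (h1 : ∀ x, g x ≤ 1) :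
    ∫⁻ x, ENNReal.ofReal (g x) ∂μ = ∫⁻ t in Ioc (0 : ℝ) 1, μ {x | t ≤ g x} := by
  rw [lintegral_eq_lintegral_meas_le μ (ae_of_all _ h0) hg.aemeasurable, ← Ioc_union_Ioi_eq_Ioi
    zero_le_one, lintegral_union measurableSet_Ioi (Ioc_disjoint_Ioi_same)]
  have hzero : ∫⁻ t in Ioi (1 : ℝ), μ {x | t ≤ g x} = 0 := by
    refine (setLIntegral_congr_fun measurableSet_Ioi fun t ht => ?_).trans (lintegral_zero)
    have : {x | t ≤ g x} = ∅ := Set.eq_empty_of_forall_notMem fun x hx =>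
      (lt_irrefl _ (lt_of_lt_of_le (lt_of_le_of_lt (h1 x) ht) hx)).elim
    rw [this, measure_empty]
  rw [hzero, add_zero]

/-- `t ↦ μ{t ≤ g}` is measurable (it is antitone). [folklore] -/
theorem measurable_measure_le_set (μ : Measure α) (g : α → ℝ) :
    Measurable fun t : ℝ => μ {x | t ≤ g x} :=
  Antitone.measurable fun _ _ hst => measure_mono fun _ hx => le_trans hst hx

/-- One-sided layer-cake comparison: `∫⁻ g dμ ≤ ∫⁻ g dν + ε` for `[0,1]`-valued measurable `g` and
`TVClose μ ν ε`. [folklore] -/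
theorem TVClose.lintegral_le_add {μ ν : Measure α} [IsFiniteMeasure μ] [IsFiniteMeasure ν] {ε : ℝ}
    (h : TVClose μ ν ε) {g : α → ℝ} (hg : Measurable g) (h0 : ∀ x, 0 ≤ g x) (h1 : ∀ x, g x ≤ 1) :
    ∫⁻ x, ENNReal.ofReal (g x) ∂μ ≤ (∫⁻ x, ENNReal.ofReal (g x) ∂ν) + ENNReal.ofReal ε := by
  rw [lintegral_eq_setLIntegral_Ioc_measure_le μ hg h0 h1,
    lintegral_eq_setLIntegral_Ioc_measure_le ν hg h0 h1]
  calc ∫⁻ t in Ioc (0 : ℝ) 1, μ {x | t ≤ g x}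
      ≤ ∫⁻ t in Ioc (0 : ℝ) 1, (ν {x | t ≤ g x} + ENNReal.ofReal ε) :=
        lintegral_mono fun t => h.measure_le_add (measurableSet_le measurable_const hg)
    _ = (∫⁻ t in Ioc (0 : ℝ) 1, ν {x | t ≤ g x}) + ENNReal.ofReal ε * volume (Ioc (0 : ℝ) 1) := by
        rw [lintegral_add_left (measurable_measure_le_set ν g), setLIntegral_const]
    _ = (∫⁻ t in Ioc (0 : ℝ) 1, ν {x | t ≤ g x}) + ENNReal.ofReal ε := by
        rw [Real.volume_Ioc, sub_zero, ENNReal.ofReal_one, mul_one]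

/-- **Integrals of `[0,1]`-valued measurable functions are `ε`-close when the measures are
`ε`-close on sets** (Levin–Peres–Wilmer 2009, Prop. 4.2 / Remark 4.3 type statement; layer-cake
formula). [folklore] -/
theorem TVClose.abs_integral_sub_le {μ ν : Measure α} [IsFiniteMeasure μ] [IsFiniteMeasure ν]
    {ε : ℝ} (h : TVClose μ ν ε) {g : α → ℝ} (hg : Measurable g) (h0 : ∀ x, 0 ≤ g x)
    (h1 : ∀ x, g x ≤ 1) : |∫ x, g x ∂μ - ∫ x, g x ∂ν| ≤ ε := by
  have hε : 0 ≤ ε := h.nonneg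
  have hgi : ∀ (ρ : Measure α) [IsFiniteMeasure ρ], Integrable g ρ := fun ρ _ =>
    Integrable.of_bound hg.aestronglyMeasurable 1 (ae_of_all _ fun x => by
      rw [Real.norm_eq_abs, abs_of_nonneg (h0 x)]; exact h1 x)
  have hfin : ∀ (ρ : Measure α) [IsFiniteMeasure ρ], ∫⁻ x, ENNReal.ofReal (g x) ∂ρ ≠ ∞ :=
    fun ρ _ => ne_top_of_le_ne_top (measure_ne_top ρ univ) (by
      calc ∫⁻ x, ENNReal.ofReal (g x) ∂ρ ≤ ∫⁻ _x, 1 ∂ρ :=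
            lintegral_mono fun x => ENNReal.ofReal_le_one.2 (h1 x)
        _ = ρ univ := lintegral_one)
  have heq : ∀ (ρ : Measure α) [IsFiniteMeasure ρ],
      ∫ x, g x ∂ρ = (∫⁻ x, ENNReal.ofReal (g x) ∂ρ).toReal := fun ρ _ =>
    integral_eq_lintegral_of_nonneg_ae (ae_of_all _ h0) hg.aestronglyMeasurable
  rw [heq μ, heq ν]
  have h12 := h.lintegral_le_add hg h0 h1
  have h21 := h.symm.lintegral_le_add hg h0 h1
  have t12 : (∫⁻ x, ENNReal.ofReal (g x) ∂μ).toReal ≤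
      (∫⁻ x, ENNReal.ofReal (g x) ∂ν).toReal + ε := by
    have := ENNReal.toReal_mono (ENNReal.add_ne_top.2 ⟨hfin ν, ENNReal.ofReal_ne_top⟩) h12
    rwa [ENNReal.toReal_add (hfin ν) ENNReal.ofReal_ne_top, ENNReal.toReal_ofReal hε] at this
  have t21 : (∫⁻ x, ENNReal.ofReal (g x) ∂ν).toReal ≤
      (∫⁻ x, ENNReal.ofReal (g x) ∂μ).toReal + ε := by
    have := ENNReal.toReal_mono (ENNReal.add_ne_top.2 ⟨hfin μ, ENNReal.ofReal_ne_top⟩) h21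
    rwa [ENNReal.toReal_add (hfin μ) ENNReal.ofReal_ne_top, ENNReal.toReal_ofReal hε] at this
  rw [abs_le]
  constructor <;> linarith

/-! ### Completeness of probability measures for the setwise distance -/

/-- **A setwise (total-variation) Cauchy sequence of probability measures converges setwise to a
probability measure, with the same rate** (completeness of `(𝒫(α), ‖·‖_TV)`; Bogachev 2007,
§4.6; Billingsley 1999, §1): if `TVClose (ρ n) (ρ m) (ε N)` whenever `n, m ≥ N` and `ε N → 0`,
there is a probability measure `P` with `TVClose (ρ n) P (ε N)` for all `n ≥ N`. [folklore] -/
theorem exists_tvClose_of_cauchy (ρ : ℕ → Measure α) [∀ n, IsProbabilityMeasure (ρ n)]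
    (ε : ℕ → ℝ) (hε : Tendsto ε atTop (𝓝 0))
    (h : ∀ N n m, N ≤ n → N ≤ m → TVClose (ρ n) (ρ m) (ε N)) :
    ∃ P : Measure α, IsProbabilityMeasure P ∧ ∀ N n, N ≤ n → TVClose (ρ n) P (ε N) := by
  classical
  -- setwise limits
  have hC : ∀ B, MeasurableSet B → CauchySeq fun n => (ρ n).real B := fun B hB =>
    cauchySeq_of_le_tendsto_0 ε (fun n m N hn hm => by
      rw [Real.dist_eq]; exact h N n m hn hm B hB) hε
  have hlim : ∀ B, MeasurableSet B → ∃ a, Tendsto (fun n => (ρ n).real B) atTop (𝓝 a) :=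
    fun B hB => cauchySeq_tendsto_of_complete (hC B hB)
  let m : Set α → ℝ := fun B => if hB : MeasurableSet B then (hlim B hB).choose else 0
  have hm : ∀ B, MeasurableSet B → Tendsto (fun n => (ρ n).real B) atTop (𝓝 (m B)) :=
    fun B hB => by simp only [m, dif_pos hB]; exact (hlim B hB).choose_spec
  have hmb : ∀ N n, N ≤ n → ∀ B, MeasurableSet B → |(ρ n).real B - m B| ≤ ε N :=
    fun N n hn B hB =>
      le_of_tendsto ((tendsto_const_nhds.sub (hm B hB)).abs)
        (eventually_atTop.2 ⟨N, fun k hk => h N n k hn hk B hB⟩)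
  have hm0 : ∀ B, MeasurableSet B → 0 ≤ m B := fun B hB =>
    ge_of_tendsto' (hm B hB) fun n => measureReal_nonneg
  have hm_empty : m ∅ = 0 :=
    tendsto_nhds_unique (hm ∅ MeasurableSet.empty) (by simp)
  have hm_univ : m univ = 1 :=
    tendsto_nhds_unique (hm _ MeasurableSet.univ) (by simp)
  -- finite additivity along the partial unions of a disjoint sequence
  have hm_partial : ∀ (B : ℕ → Set α), (∀ i, MeasurableSet (B i)) → Pairwise (Disjoint on B) →
      ∀ k : ℕ, m (⋃ i ∈ Finset.range k, B i) = ∑ i ∈ Finset.range k, m (B i) := by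
    intro B hB hd k
    have hmeas : MeasurableSet (⋃ i ∈ Finset.range k, B i) :=
      Finset.measurableSet_biUnion _ fun i _ => hB i
    refine tendsto_nhds_unique (hm _ hmeas) ?_
    have heq : ∀ n, (ρ n).real (⋃ i ∈ Finset.range k, B i) = ∑ i ∈ Finset.range k, (ρ n).real (B i) :=
      fun n => measureReal_biUnion_finset (fun i _ j _ hij => hd hij) fun i _ => hB i
    simp_rw [heq]
    exact tendsto_finsetSum _ fun i _ => hm _ (hB i)
  -- countable additivity
  have hm_iUnion : ∀ (B : ℕ → Set α), (∀ i, MeasurableSet (B i)) → Pairwise (Disjoint on B) →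
      HasSum (fun i => m (B i)) (m (⋃ i, B i)) := by
    intro B hB hd
    rw [hasSum_iff_tendsto_nat_of_nonneg (fun i => hm0 _ (hB i))]
    simp_rw [← hm_partial B hB hd]
    have hU : MeasurableSet (⋃ i, B i) := MeasurableSet.iUnion hB
    rw [Metric.tendsto_atTop]
    intro δ hδ
    -- choose `N` with `ε N < δ / 3`, then `K` from continuity of the measure `ρ N`
    obtain ⟨N, hN⟩ := (Metric.tendsto_atTop.1 hε) (δ / 3) (by positivity)
    have hεN : ε N < δ / 3 := by
      have := hN N le_rfl
      rw [Real.dist_eq, sub_zero] at this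
      exact lt_of_le_of_lt (le_abs_self _) this
    have hmono : Monotone fun k => ⋃ i ∈ Finset.range k, B i := fun k l hkl =>
      Set.biUnion_subset_biUnion_left fun i hi => Finset.mem_range.2
        (lt_of_lt_of_le (Finset.mem_range.1 hi) hkl)
    have hunion : (⋃ k, ⋃ i ∈ Finset.range k, B i) = ⋃ i, B i := by
      apply subset_antisymm
      · exact Set.iUnion_subset fun k => Set.iUnion₂_subset fun i _ => Set.subset_iUnion B i
      · exact Set.iUnion_subset fun i x hx =>
          Set.mem_iUnion.2 ⟨i + 1, Set.mem_iUnion₂.2 ⟨i, Finset.mem_range.2 (Nat.lt_succ_self i), hx⟩⟩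
    have hcont : Tendsto (fun k => (ρ N).real (⋃ i ∈ Finset.range k, B i)) atTop
        (𝓝 ((ρ N).real (⋃ i, B i))) := by
      have h1 := tendsto_measure_iUnion_atTop (μ := ρ N) hmono
      rw [hunion] at h1
      exact (ENNReal.tendsto_toReal (measure_ne_top _ _)).comp h1
    obtain ⟨K, hK⟩ := (Metric.tendsto_atTop.1 hcont) (δ / 3) (by positivity)
    refine ⟨K, fun k hk => ?_⟩
    have hk' := hK k hk
    rw [Real.dist_eq] at hk' ⊢
    have hmeas : MeasurableSet (⋃ i ∈ Finset.range k, B i) :=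
      Finset.measurableSet_biUnion _ fun i _ => hB i
    have e1 := hmb N N le_rfl _ hmeas
    have e2 := hmb N N le_rfl _ hU
    rw [abs_lt]
    rw [abs_le] at e1 e2
    rw [abs_lt] at hk'
    constructor <;> linarith
  -- the limit measure
  let P : Measure α := Measure.ofMeasurable (fun B _ => ENNReal.ofReal (m B))
    (by simp [hm_empty]) (by
      intro B hB hd
      rw [← ENNReal.ofReal_tsum_of_nonneg (fun i => hm0 _ (hB i)) (hm_iUnion B hB hd).summable,
        (hm_iUnion B hB hd).tsum_eq])
  have hP : ∀ B, MeasurableSet B → P B = ENNReal.ofReal (m B) := fun B hB =>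
    Measure.ofMeasurable_apply B hB
  have hPr : ∀ B, MeasurableSet B → P.real B = m B := fun B hB => by
    rw [measureReal_def, hP B hB, ENNReal.toReal_ofReal (hm0 B hB)]
  refine ⟨P, ⟨by rw [hP _ MeasurableSet.univ, hm_univ, ENNReal.ofReal_one]⟩, fun N n hn B hB => ?_⟩
  rw [hPr B hB]
  exact hmb N n hn B hB

end Literature.MeasureTheory.TotalVariation
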